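import Literature.Computability.AlgebraicComplexity.ConstantFreeCompleteness
import Literature.Computability.AlgebraicComplexity.DeterminantalConormalBoundKernelAlgebra
import Mathlib.LinearAlgebra.Matrix.AbsoluteValue
import HarnessLib

/-!
# Affine sign-determinantal expressions: `τ`-cost, evaluation bounds, and the size of `N`, `d`

A *sign-determinantal expression* of `N · per_p^d` (the objects of the quasi-polynomial form of
Bürgisser's transfer theorem, Bürgisser 2009, Thm. 1.1(2) / Lemma 2.12) is an identity
`det A = N · per_p^d` with `A` an `m × m` matrix of AFFINE forms in the `p²` variables `X_{ij}`
all of whose coefficients lie in `{−1, 0, 1}`. This file collects the elementary estimates used to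
evaluate such an expression by constant-free circuits and to read off its value in binary:

* an affine form with coefficients in `{−1, 0, 1}` over `σ` is constant-free of cost `≤ 2|σ| + 1`
  and has absolute value `≤ 1 + |σ| M` at a point of sup-norm `≤ M`
  (`constantFreeComplexity_le_of_affine_unit`, `abs_eval_le_of_affine_unit`);
* `det A` is the substitution instance of `DET_m` at the entries of `A`, so
  `τ(det A) ≤ τ(DET_m) + ∑ τ(A_{ij})` (`aeval_entries_detPoly`, `constantFreeComplexity_det_le`);
* `per_p` at the all-twos matrix is `p! 2^p` (`eval_const_two_perPoly`), and a determinant of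
  affine unit forms at a point of sup-norm `≤ M` is at most `m! (1 + |σ| M)^m`
  (`abs_eval_det_le_of_affine_unit`, from Mathlib's Hadamard-type bound `Matrix.det_le`);
* hence `det A = N · per_p^d`, `N ≠ 0`, `p ≥ 1` force `|N| ≤ 2^E` and `d ≤ E` with
  `E = m² + 2 p² m` (`signDetExpr_bounds`).

References: P. Bürgisser, *On defining integers and proving arithmetic circuit lower bounds*,
Comput. Complexity 18 (2009) 81–103, §1 and Lemma 2.12; P. Bürgisser, *Completeness and
Reduction in Algebraic Complexity Theory*, Springer 2000, Rem. 2.7 (substitution).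
-/

noncomputable section

open MvPolynomial

namespace Literature.Computability.AlgebraicComplexity

/-! ### Affine forms with coefficients in `{−1, 0, 1}` -/

/-- An affine form with coefficients in `{−1, 0, 1}` over `σ` is constant-free of cost
`≤ 2 |σ| + 1`: `a = a₀ + ∑ᵢ aᵢ Xᵢ` with sign constants `a₀, aᵢ`. [folklore] -/
theorem constantFreeComplexity_le_of_affine_unit {σ : Type*} [Fintype σ] {a : MvPolynomial σ ℤ}
    (hdeg : a.totalDegree ≤ 1) (hco : ∀ s, |coeff s a| ≤ 1) :
    constantFreeComplexity a ≤ 2 * Fintype.card σ + 1 := by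
  have hsc : ∀ s, ArithCircuit.IsSignConstant (coeff s a) := fun s => by
    have := abs_le.mp (hco s)
    unfold ArithCircuit.IsSignConstant
    omega
  rw [DeterminantalConormal.eq_C_add_sum_of_totalDegree_le_one hdeg]
  calc constantFreeComplexity (C (coeff 0 a) + ∑ i, C (coeff (Finsupp.single i 1) a) * X i)
      ≤ constantFreeComplexity (C (coeff 0 a) : MvPolynomial σ ℤ) +
          constantFreeComplexity (∑ i, C (coeff (Finsupp.single i 1) a) * X i : MvPolynomial σ ℤ) + 1 :=
        constantFreeComplexity_add_le _ _
    _ ≤ 0 + (∑ _i : σ, 1 + Fintype.card σ) + 1 := by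
        gcongr
        · exact (constantFreeComplexity_C_of_isSignConstant (hsc 0)).le
        · refine (constantFreeComplexity_finset_sum_le _ _).trans (Nat.add_le_add ?_ Finset.card_univ.le)
          refine Finset.sum_le_sum fun i _ => (constantFreeComplexity_mul_le _ _).trans ?_
          rw [constantFreeComplexity_C_of_isSignConstant (hsc _), constantFreeComplexity_X]
    _ = 2 * Fintype.card σ + 1 := by simp; ring

/-- The value of an affine form with coefficients in `{−1, 0, 1}` at a point of sup-norm `≤ M`
is at most `1 + |σ| M` in absolute value. [folklore] -/
theorem abs_eval_le_of_affine_unit {σ : Type*} [Fintype σ] {a : MvPolynomial σ ℤ}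
    (hdeg : a.totalDegree ≤ 1) (hco : ∀ s, |coeff s a| ≤ 1) {z : σ → ℤ} {M : ℤ}
    (hz : ∀ v, |z v| ≤ M) : |eval z a| ≤ 1 + Fintype.card σ * M := by
  rw [DeterminantalConormal.eval_eq_coeff_zero_add_sum hdeg z]
  calc |coeff 0 a + ∑ i, coeff (Finsupp.single i 1) a * z i|
      ≤ |coeff 0 a| + |∑ i, coeff (Finsupp.single i 1) a * z i| := abs_add_le _ _
    _ ≤ 1 + ∑ i, |coeff (Finsupp.single i 1) a * z i| :=
        add_le_add (hco 0) (Finset.abs_sum_le_sum_abs _ _)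
    _ ≤ 1 + ∑ _i : σ, M := by
        gcongr with i
        rw [abs_mul]
        calc |coeff (Finsupp.single i 1) a| * |z i| ≤ 1 * M :=
              mul_le_mul (hco _) (hz i) (abs_nonneg _) zero_le_one
          _ = M := one_mul M
    _ = 1 + Fintype.card σ * M := by simp [Finset.sum_const, Finset.card_univ]

/-! ### Determinants: substitution form and evaluation bounds -/

/-- The determinant of an `N × N` matrix over `ℤ[X]` is the substitution instance of the generic
determinant `DET_N` at its entries (cf. `aeval_entries_perPoly`). [folklore] -/
theorem aeval_entries_detPoly {σ : Type*} {N : ℕ} (A : Matrix (Fin N) (Fin N) (MvPolynomial σ ℤ)) :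
    aeval (fun ij : Fin N × Fin N => A ij.1 ij.2) (detPoly (Fin N) ℤ) = A.det := by
  unfold detPoly
  rw [AlgHom.map_det]
  congr 1
  ext i j
  simp [Matrix.mvPolynomialX_apply]

/-- `τ(det A) ≤ τ(DET_N) + ∑_{ij} τ(A_{ij})`: plug circuits for the entries into a circuit for the
generic determinant (Bürgisser 2000, Rem. 2.7). [cite: Burgisser2000, Rem. 2.7] -/
theorem constantFreeComplexity_det_le {σ : Type*} {N : ℕ} (A : Matrix (Fin N) (Fin N) (MvPolynomial σ ℤ)) :
    constantFreeComplexity A.det ≤ constantFreeComplexity (detPoly (Fin N) ℤ) +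
      ∑ ij : Fin N × Fin N, constantFreeComplexity (A ij.1 ij.2) := by
  rw [← aeval_entries_detPoly]
  exact constantFreeComplexity_aeval_le _ _

/-- The generic permanent at the all-twos matrix: `PER_p(2, …, 2) = p! · 2^p`. [folklore] -/
theorem eval_const_two_perPoly (p : ℕ) :
    eval (fun _ => (2 : ℤ)) (perPoly (Fin p) ℤ) = (p.factorial : ℤ) * 2 ^ p := by
  unfold perPoly Matrix.permanent
  simp [map_sum, map_prod, Matrix.mvPolynomialX_apply, Finset.prod_const, Finset.card_univ,
    Fintype.card_perm]

/-- Hadamard-type bound: a determinant of affine forms with coefficients in `{−1, 0, 1}`,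
evaluated at a point of sup-norm `≤ M`, is at most `N! (1 + |σ| M)^N` in absolute value
(`Matrix.det_le`). [folklore] -/
theorem abs_eval_det_le_of_affine_unit {σ : Type*} [Fintype σ] {N : ℕ}
    (A : Matrix (Fin N) (Fin N) (MvPolynomial σ ℤ)) (hdeg : ∀ i j, (A i j).totalDegree ≤ 1)
    (hco : ∀ i j s, |coeff s (A i j)| ≤ 1) {z : σ → ℤ} {M : ℤ} (hz : ∀ v, |z v| ≤ M) :
    |eval z A.det| ≤ (N.factorial : ℤ) * (1 + Fintype.card σ * M) ^ N := by
  rw [RingHom.map_det, RingHom.mapMatrix_apply]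
  have h := Matrix.det_le (abv := AbsoluteValue.abs) (A := A.map (eval z))
    (x := 1 + Fintype.card σ * M) fun i j => by
      rw [Matrix.map_apply, AbsoluteValue.abs_apply]
      exact abs_eval_le_of_affine_unit (hdeg i j) (hco i j) hz
  simpa [nsmul_eq_mul] using h

/-- **Crude bounds from a sign-determinantal expression** `det A = N · per_p^d`, `A` an `m × m`
matrix of affine forms with coefficients in `{−1, 0, 1}`, `N ≠ 0`, `p ≥ 1`: evaluating at the
all-twos matrix, `|N| · (p! 2^p)^d ≤ m! (1 + 2p²)^m ≤ 2^E` with `E = m² + 2p²m`, whence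
`|N| ≤ 2^E` and `d ≤ E`. [folklore] -/
theorem signDetExpr_bounds {p m d : ℕ} {N : ℤ}
    (A : Matrix (Fin m) (Fin m) (MvPolynomial (Fin p × Fin p) ℤ)) (hp : 1 ≤ p) (hN : N ≠ 0)
    (hdeg : ∀ i j, (A i j).totalDegree ≤ 1) (hco : ∀ i j s, |coeff s (A i j)| ≤ 1)
    (hA : A.det = C N * perPoly (Fin p) ℤ ^ d) :
    N.natAbs ≤ 2 ^ (m * m + 2 * p * p * m) ∧ d ≤ m * m + 2 * p * p * m := by
  set z : Fin p × Fin p → ℤ := fun _ => 2 with hz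
  have hP : (2 : ℤ) ≤ eval z (perPoly (Fin p) ℤ) := by
    rw [hz, eval_const_two_perPoly]
    calc (2 : ℤ) = 1 * 2 ^ 1 := by norm_num
      _ ≤ (p.factorial : ℤ) * 2 ^ p :=
          mul_le_mul (by exact_mod_cast p.factorial_pos) (pow_le_pow_right₀ (by norm_num) hp)
            (by norm_num) (by positivity)
  have hev : eval z A.det = N * eval z (perPoly (Fin p) ℤ) ^ d := by rw [hA]; simp
  have hB : |eval z A.det| ≤ (m.factorial : ℤ) * (1 + (p * p : ℕ) * 2) ^ m := by
    have := abs_eval_det_le_of_affine_unit A hdeg hco (z := z) (M := 2) fun _ => by simp [hz]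
    simpa [Fintype.card_prod, Fintype.card_fin] using this
  have hBE : m.factorial * (1 + p * p * 2) ^ m ≤ 2 ^ (m * m + 2 * p * p * m) := by
    have h1 : m.factorial ≤ 2 ^ (m * m) :=
      (Nat.factorial_le_pow m).trans (by
        rw [pow_mul]; exact Nat.pow_le_pow_left Nat.lt_two_pow_self.le _)
    have h2 : (1 + p * p * 2) ^ m ≤ 2 ^ (2 * p * p * m) := by
      rw [pow_mul]
      refine Nat.pow_le_pow_left ?_ _
      have := @Nat.lt_two_pow_self (2 * p * p)
      rw [show 1 + p * p * 2 = 2 * p * p + 1 by ring]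
      omega
    rw [pow_add]
    exact Nat.mul_le_mul h1 h2
  have key : |N| * eval z (perPoly (Fin p) ℤ) ^ d ≤ 2 ^ (m * m + 2 * p * p * m) := by
    rw [← abs_of_nonneg (show (0 : ℤ) ≤ eval z (perPoly (Fin p) ℤ) ^ d by positivity), ← abs_mul,
      ← hev]
    refine hB.trans ?_
    exact_mod_cast hBE
  have hN1 : 1 ≤ |N| := Int.one_le_abs hN
  have hPd : (2 : ℤ) ^ d ≤ eval z (perPoly (Fin p) ℤ) ^ d := pow_le_pow_left₀ (by norm_num) hP d
  have hPd1 : 1 ≤ eval z (perPoly (Fin p) ℤ) ^ d := le_trans (one_le_pow₀ (by norm_num)) hPd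
  constructor
  · have h1 : |N| ≤ 2 ^ (m * m + 2 * p * p * m) :=
      le_trans (le_mul_of_one_le_right (abs_nonneg _) hPd1) key
    have h2 : ((N.natAbs : ℕ) : ℤ) ≤ ((2 ^ (m * m + 2 * p * p * m) : ℕ) : ℤ) := by
      rw [Int.natCast_natAbs]; exact_mod_cast h1
    exact_mod_cast h2
  · have h1 : (2 : ℤ) ^ d ≤ 2 ^ (m * m + 2 * p * p * m) :=
      hPd.trans ((le_mul_of_one_le_left (by positivity) hN1).trans key)
    have h2 : 2 ^ d ≤ 2 ^ (m * m + 2 * p * p * m) := by exact_mod_cast h1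
    exact (Nat.pow_le_pow_iff_right (by norm_num)).1 h2

end Literature.Computability.AlgebraicComplexity
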